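import Literature.NumberTheory.Automorphic.Liu2021.Prop413AsPrinted
import Literature.NumberTheory.Automorphic.IdeleClassCharacterConjugate
import Literature.AlgebraicGeometry.Liu2021.AdmissibleElement
import HarnessLib

/-!
# [Liu2021, Prop. 4.13 / Def. 4.11–4.12] the CONJUGATE PARTNER `(μ∘c, −ε, χ′)` of a weight-one admissible oscillator triple

Topic `NumberTheory/Automorphic/Liu2021`; namespace `Literature.NumberTheory.Automorphic.Liu2021.Prop413Data`.  THEOREMS ONLY (no definition,
no named fact, no instance, no `sorry`).  Cell `hodgecm-mathlib`, FLOOR-0 P4, stub S5 `stub_T3b_conjugatePartnerAt` of the registered line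
`Cruxes/H413/Lines/F0_P4AdmissibleOccursInH1.lean` (commit 6943db7daf45): its TRIPLE half.  HC_CM is proved only modulo the 7 printed citations until
rung 0 closes; this file proves no cell binder.

## What is proved

For ANY datum `P : Prop413Data F E` ([Liu2021] §4.2 carriers) and any adèlic oscillator triple `t = (μ, ε, χ)` of `P` with `μ` OF WEIGHT ONE and `ε`
`μ`-ADMISSIBLE (witness `e ∈ E^{×−}`, `ε = epsOf e`), and any `χ′ : P.Chi`, the triple `t′ := (μ ∘ c, epsOf (−e), χ′)` is again an oscillator triple
of WEIGHT ONE, `μ∘c`-ADMISSIBLE (witness `−e`), and its CM type is the CONJUGATE type: `Φ_{μ∘c} = Φ̄_μ`, so `ι ∈ Φ_{μ∘c} ↔ ι ∉ Φ_μ` for every embedding `ι`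
([Liu2021] Remark 4.4: «`μ^c` is conjugate symplectic of the same weight», `Φ_{μ^c} = Φ̄_μ`; Def. 4.12, last sentence: «`ε` is `μ`-admissible iff `−ε` is
`μ^c`-admissible»).  Everything is the tree's ★ `IdeleClassGroup.galConj` calculus (`IsConjugateSymplectic.galConj`, `HasWeight.galConj_complexConj`,
`IsConjugateSymplectic.cmType_galConj`) and ★ `isAdmissibleElement_conj_neg_iff`.  The conjugate-linear intertwiner `ω(t) → ω(t′)` (the other half of S5)
is NOT here.

## References
* [Liu2021] Y. Liu, *Fourier–Jacobi cycles and arithmetic relative trace formula*, Camb. J. Math. 9 (2021): §4.1 Remark 4.4 (FJcycle.tex l. 1922–1926),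
  Def. 4.11–4.12 (l. 2083–2108), Prop. 4.13 (l. 2113–2119).
* [GelbartRogawski1991] S. Gelbart, J. Rogawski, Invent. Math. 105 (1991), §3 Prop. 3.1.1.
-/

set_option autoImplicit false

noncomputable section

open NumberField
open Literature.AlgebraicGeometry.Motives (CMType)
open Literature.AlgebraicGeometry.Liu2021 (IsAdmissibleElement isAdmissibleElement_conj_neg_iff)
open Literature.NumberTheory.ComplexMultiplication.CMTypeOps (bar mem_bar_iff coe_bar_eq_setOf_conjugate_mem)
open Literature.NumberTheory.Automorphic.IdeleClassGroup (galConj IsConjugateSymplectic)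

namespace Literature.NumberTheory.Automorphic.Liu2021.Prop413Data

variable {F E : Type} [Field F] [NumberField F] [IsTotallyReal F] [Field E] [NumberField E] [Algebra F E]
  [IsTotallyComplex E] [Algebra.IsQuadraticExtension F E] {P : Prop413Data F E}

/-- **The conjugate partner triple** ([Liu2021] Remark 4.4 + Def. 4.12, last sentence): for `t = (μ, ε, χ)` with `μ` of weight one and
`ε = epsOf e` `μ`-admissible, and any `χ′`, the triple `(μ ∘ c, epsOf (−e), χ′)` is of weight one, `μ∘c`-admissible with witness `−e`, and has the
conjugate CM type `Φ̄_μ`. [cite: Liu2021, Remark 4.4 (FJcycle.tex l. 1922–1926) and Def. 4.12 (l. 2102–2108)] -/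
theorem Triple.exists_conjPartner (t : P.Triple) (hw : t.HasWeightOne) (ha : t.IsAdmissible) (χ' : P.Chi) :
    letI : IsCMField E := isCMField F E
    ∃ t' : P.Triple, t'.μ = galConj (IsCMField.complexConj E) t.μ ∧ t'.χ = χ' ∧ t'.HasWeightOne ∧ t'.IsAdmissible ∧
      t'.cmType = bar t.cmType ∧
      ∃ e : E, IsAdmissibleElement E t.cmType.1 e ∧ P.epsOf e = t.ε ∧ P.epsOf (-e) = t'.ε := by
  letI : IsCMField E := isCMField F E
  obtain ⟨e, he, hε⟩ := ha
  refine ⟨⟨galConj (IsCMField.complexConj E) t.μ, t.isConjugateSymplectic.galConj, P.epsOf (-e), χ'⟩, rfl, rfl, ?_, ?_, ?_, e, he, hε, rfl⟩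
  · exact hw.galConj_complexConj
  · refine ⟨-e, ?_, rfl⟩
    show IsAdmissibleElement E (t.isConjugateSymplectic.galConj.cmType).1 (-e)
    rw [t.isConjugateSymplectic.cmType_galConj, coe_bar_eq_setOf_conjugate_mem]
    exact (isAdmissibleElement_conj_neg_iff _ e).2 he
  · exact t.isConjugateSymplectic.cmType_galConj

/-- **The partner's CM type is complementary**: `ι ∈ Φ_{μ∘c} ↔ ι ∉ Φ_μ` for every embedding `ι : E → ℂ` — the «`ι₁`-class flipped» clause
of the P4 stub `stub_T3b_conjugatePartnerAt`. [cite: Liu2021, Remark 4.4 (FJcycle.tex l. 1922–1926)] -/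
theorem Triple.exists_conjPartner_flip (t : P.Triple) (hw : t.HasWeightOne) (ha : t.IsAdmissible) (χ' : P.Chi) (ι : E →+* ℂ) :
    letI : IsCMField E := isCMField F E
    ∃ t' : P.Triple, t'.μ = galConj (IsCMField.complexConj E) t.μ ∧ t'.χ = χ' ∧ t'.HasWeightOne ∧ t'.IsAdmissible ∧
      (ι ∈ t'.cmType.1 ↔ ι ∉ t.cmType.1) ∧
      ∃ e : E, IsAdmissibleElement E t.cmType.1 e ∧ P.epsOf e = t.ε ∧ P.epsOf (-e) = t'.ε := by
  letI : IsCMField E := isCMField F E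
  obtain ⟨t', h1, h2, h3, h4, h5, h6⟩ := t.exists_conjPartner hw ha χ'
  refine ⟨t', h1, h2, h3, h4, ?_, h6⟩
  rw [h5]
  exact mem_bar_iff _ _

end Literature.NumberTheory.Automorphic.Liu2021.Prop413Data

end
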